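import Literature.AlgebraicGeometry.Motives.AbelianVarietyTateSimpleCharpoly
import Literature.AlgebraicGeometry.Motives.AbelianVarietyPoincarePerfectField
import Literature.NumberTheory.DiophantineGeometry.AVIsogenyTateRationalEquivProofs
import HarnessLib

/-!
# Discharged fact: the characteristic polynomial of Frobenius is a product of characteristic
# polynomials of Frobenius of simple abelian varieties (Poincaré–Weil over `𝔽_q`, read on `P_A`)

Sibling proof file of `Literature/AlgebraicGeometry/Motives/AbelianVarietyTateSimpleCharpoly.lean`,
which records as a named fact

* `Literature.AlgebraicGeometry.Motives.AbelianVariety.frobCharpolyProdSimple K : Prop` — for a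
  finite field `K`: the characteristic polynomial of the Frobenius of an abelian variety of positive
  dimension over `K` (`AbelianVariety.IsFrobCharpoly`, file `AbelianVarietyHondaTate`) is a finite
  product of characteristic polynomials of Frobenius of `K`-simple abelian varieties of positive
  dimension over `K` (Tate, Sém. Bourbaki 352, p. 95 "`M(k)` est semi-simple" and p. 99 "`f_A` […]
  c'est aussi celui de l'endomorphisme de `V_ℓ(A)` défini par `π_A`"; Waterhouse 1969, p. 522 and
  Ch. 2 p. 526; Zywina 2014, § 2.1; Mumford § 19 Thm. 1 and Cor. 1),

proved here as `AbelianVariety.frobCharpolyProdSimple_holds`.  The statement file could not prove it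
when it was written because the tree's Poincaré decomposition (`exists_isogeny_from_productOf_simple`)
assumed `K` algebraically closed; it is now available over every PERFECT field
(`AbelianVariety.exists_isogeny_from_productOf_simple_of_perfectField`,
`Motives/AbelianVarietyPoincarePerfectField`), in particular over the finite field `K`
(Mathlib `PerfectField.ofFinite`).

## Proof (the printed one: Tate p. 95 / p. 99; Waterhouse p. 522 and p. 526)

Waterhouse, *Abelian varieties over finite fields* (1969), p. 522 (held copy
`paper:doi-10-24033-asens-1183`, PDF p. 3): "the Poincaré–Weil theorem that any abelian variety is
isogenous to a product of elementary abelian varieties (those with only finite subgroups) is used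
without comment"; Ch. 2, p. 526 (PDF p. 7): "the Frobenius endomorphism `π` of `A` over `k` has a
characteristic polynomial `h_A`. […] THEOREM (Tate). — The varieties `A` and `B` are isogenous over `k`
if and only if `h_A = h_B`."  Only the direction "isogenous ⇒ `h_A = h_B`" of the last sentence is used
(and proved) here:

1. `IsFrobCharpoly.of_isIsogeny` / `IsFrobCharpoly.of_isIsogeny_source` — **`P_A` is an isogeny
   invariant**: for an isogeny `f : B ⟶ A`, `V_ℓ f = ℚ_ℓ ⊗ T_ℓ f` is a `ℚ_ℓ`-linear bijection
   (`IsIsogeny.bijective_baseChange_tateModuleMap`, Mumford § 19 p. 172) intertwining `V_ℓ(π_B)` and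
   `V_ℓ(π_A)` (naturality of the Frobenius, `frobeniusHom_comp`), so
   `charpoly (π_B | T_ℓ B) = charpoly (π_A | T_ℓ A)` in `ℤ_ℓ[X] ⊆ ℚ_ℓ[X]`
   (Mathlib `LinearMap.charpoly_baseChange`, `LinearEquiv.charpoly_conj`);
2. `IsFrobCharpoly.prod` — **`P_{A × A'} = P_A · P_{A'}`** for the product `AbelianVariety.prod`
   (the tree's `IsFrobCharpoly.bicone` at the biproduct `A ⊞ A'`, Mumford § 19 p. 176, transported
   along `A ⊞ A' ≅ A.prod A'` by step 1);
3. `IsProductOf.exists_isFrobCharpoly_prod` — by induction on a finite product `Π` of simple abelian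
   varieties (`AbelianVariety.IsProductOf IsSimple`), `P_Π = ∏ P_{A_i}` over its simple factors `A_i`
   of positive dimension (a factor of dimension `0` — vacuously simple — contributes the polynomial
   `1`: `rank T_ℓ = 2 dim = 0`, `IsFrobCharpoly.one_of_dim_eq_zero`);
4. `frobCharpolyProdSimple_holds` — for `C` over the finite (hence perfect) field `K`, Poincaré–Weil
   gives an isogeny `Π ⟶ C` from such a `Π`; by steps 1 and 3, `P_C = P_Π = ∏ P_{A_i}`
   (uniqueness of `P_C`, `IsFrobCharpoly.eq`).

Everything is proved; no definition, no named fact (D-0026).  Net Literature debt **−1**.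

## References

* [Tate1971HondaBourbaki] J. Tate, *Classes d'isogénie des variétés abéliennes sur un corps fini
  (d'après T. Honda)*, Sém. Bourbaki 352 (1968/69), LNM 175 (1971), p. 95 and p. 99.
* [Waterhouse1969] W. C. Waterhouse, *Abelian varieties over finite fields*, Ann. sci. ÉNS (4) 2
  (1969), p. 522 and Ch. 2, p. 526 (held: `paper:doi-10-24033-asens-1183`, PDF pp. 3, 7).
* [Zywina2014SplittingReductions] D. Zywina, *The splitting of reductions of an abelian variety*,
  IMRN 2014, § 2.1 (proof of Lemma 2.1: "`P_B(x) = ∏ P_{B_i}(x)^{n_i}`").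
* [MumfordAV1970] D. Mumford, *Abelian Varieties* (1970), § 19 Thm. 1, Cor. 1, p. 172 and p. 176.
-/

noncomputable section

open Polynomial CategoryTheory CategoryTheory.Limits

universe u

namespace Literature.AlgebraicGeometry.Motives

namespace AbelianVariety

variable {K : Type u} [Field K] [Finite K]

/-! ## Step 1: `P_A` is an isogeny invariant (Waterhouse p. 526, "only if"; Mumford § 19 p. 172) -/

/-- **The characteristic polynomial of Frobenius on `T_ℓ` is an isogeny invariant.**  For an isogeny
`f : B ⟶ A` of abelian varieties over the finite field `K` and a prime `ℓ` (with finite free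
`ℤ_ℓ`-structures on both Tate modules), `charpoly (π_B | T_ℓ B) = charpoly (π_A | T_ℓ A)` in `ℤ_ℓ[X]`:
`V_ℓ f` is a `ℚ_ℓ`-linear bijection (`IsIsogeny.bijective_baseChange_tateModuleMap`) conjugating
`V_ℓ(π_B)` into `V_ℓ(π_A)` (`frobeniusHom_comp`), and `ℤ_ℓ[X] → ℚ_ℓ[X]` is injective.
[cite: Waterhouse1969, Ch. 2 p. 526 (Theorem (Tate), "only if")] [cite: MumfordAV1970, §19 p. 172] -/
theorem charpoly_tateModuleMap_frobeniusHom_eq_of_isIsogeny {A B : AbelianVariety K} {f : B ⟶ A}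
    (hf : IsIsogeny f) (ℓ : ℕ) [Fact ℓ.Prime]
    [Module.Free ℤ_[ℓ] (A.tateModule ℓ)] [Module.Finite ℤ_[ℓ] (A.tateModule ℓ)]
    [Module.Free ℤ_[ℓ] (B.tateModule ℓ)] [Module.Finite ℤ_[ℓ] (B.tateModule ℓ)] :
    (tateModuleMap ℓ (frobeniusHom B)).charpoly = (tateModuleMap ℓ (frobeniusHom A)).charpoly := by
  apply Polynomial.map_injective (algebraMap ℤ_[ℓ] ℚ_[ℓ]) (IsFractionRing.injective ℤ_[ℓ] ℚ_[ℓ])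
  rw [← LinearMap.charpoly_baseChange (tateModuleMap ℓ (frobeniusHom B)) ℚ_[ℓ],
    ← LinearMap.charpoly_baseChange (tateModuleMap ℓ (frobeniusHom A)) ℚ_[ℓ]]
  -- `V_ℓ f : V_ℓ B ≃ V_ℓ A`
  let e : TensorProduct ℤ_[ℓ] ℚ_[ℓ] (B.tateModule ℓ) ≃ₗ[ℚ_[ℓ]] TensorProduct ℤ_[ℓ] ℚ_[ℓ] (A.tateModule ℓ) :=
    LinearEquiv.ofBijective ((tateModuleMap ℓ f).baseChange ℚ_[ℓ])
      (hf.bijective_baseChange_tateModuleMap ℓ)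
  -- naturality of `π`: `T_ℓ f ∘ T_ℓ π_B = T_ℓ π_A ∘ T_ℓ f`, then base-changed
  have hnat : (tateModuleMap ℓ f).comp (tateModuleMap ℓ (frobeniusHom B)) =
      (tateModuleMap ℓ (frobeniusHom A)).comp (tateModuleMap ℓ f) := by
    rw [← tateModuleMap_comp, ← tateModuleMap_comp, frobeniusHom_comp]
  have hnat' : ((tateModuleMap ℓ f).baseChange ℚ_[ℓ]).comp
        ((tateModuleMap ℓ (frobeniusHom B)).baseChange ℚ_[ℓ]) =
      ((tateModuleMap ℓ (frobeniusHom A)).baseChange ℚ_[ℓ]).comp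
        ((tateModuleMap ℓ f).baseChange ℚ_[ℓ]) := by
    rw [← LinearMap.baseChange_comp, ← LinearMap.baseChange_comp, hnat]
  have key : e.conj ((tateModuleMap ℓ (frobeniusHom B)).baseChange ℚ_[ℓ]) =
      (tateModuleMap ℓ (frobeniusHom A)).baseChange ℚ_[ℓ] := by
    apply LinearMap.ext
    intro y
    obtain ⟨x, rfl⟩ := e.surjective y
    have h := LinearMap.congr_fun hnat' x
    simp only [LinearMap.comp_apply] at h
    rw [LinearEquiv.conj_apply, LinearMap.comp_apply, LinearMap.comp_apply, LinearEquiv.coe_coe,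
      LinearEquiv.coe_coe, e.symm_apply_apply]
    exact h
  rw [← key, LinearEquiv.charpoly_conj]

/-- **`P_A` is an isogeny invariant, pulled back**: if `f : B ⟶ A` is an isogeny and `P` is the
characteristic polynomial of the Frobenius of `A`, then `P` is that of `B` ("`A` and `B` isogenous over
`k` ⇒ `h_A = h_B`"). [cite: Waterhouse1969, Ch. 2 p. 526 (Theorem (Tate), "only if")]
[cite: Tate1971HondaBourbaki, p. 99] -/
theorem IsFrobCharpoly.of_isIsogeny {A B : AbelianVariety K} {f : B ⟶ A} (hf : IsIsogeny f)
    {P : ℤ[X]} (hP : A.IsFrobCharpoly P) : B.IsFrobCharpoly P := by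
  intro ℓ _ _ _ hℓ
  haveI := module_free_tateModule_holds A ℓ hℓ
  haveI := module_finite_tateModule_of_cast_ne_zero A ℓ hℓ
  rw [charpoly_tateModuleMap_frobeniusHom_eq_of_isIsogeny hf ℓ]
  exact hP ℓ hℓ

/-- **`P_A` is an isogeny invariant, pushed forward**: if `f : B ⟶ A` is an isogeny and `P` is the
characteristic polynomial of the Frobenius of `B`, then `P` is that of `A`.
[cite: Waterhouse1969, Ch. 2 p. 526 (Theorem (Tate), "only if")] [cite: Tate1971HondaBourbaki, p. 99] -/
theorem IsFrobCharpoly.of_isIsogeny_source {A B : AbelianVariety K} {f : B ⟶ A} (hf : IsIsogeny f)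
    {P : ℤ[X]} (hP : B.IsFrobCharpoly P) : A.IsFrobCharpoly P := by
  intro ℓ _ _ _ hℓ
  haveI := module_free_tateModule_holds B ℓ hℓ
  haveI := module_finite_tateModule_of_cast_ne_zero B ℓ hℓ
  rw [← charpoly_tateModuleMap_frobeniusHom_eq_of_isIsogeny hf ℓ]
  exact hP ℓ hℓ

/-- Isogenous abelian varieties (the tree's ordered relation `IsIsogenous B A`: an isogeny `B ⟶ A`)
have the same characteristic polynomials of Frobenius.
[cite: Waterhouse1969, Ch. 2 p. 526 (Theorem (Tate), "only if")] -/
theorem IsIsogenous.isFrobCharpoly_iff {A B : AbelianVariety K} (h : IsIsogenous B A) (P : ℤ[X]) :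
    B.IsFrobCharpoly P ↔ A.IsFrobCharpoly P := by
  obtain ⟨f, hf⟩ := h
  exact ⟨fun hP => hP.of_isIsogeny_source hf, fun hP => hP.of_isIsogeny hf⟩

/-! ## Step 2: products (Mumford § 19 p. 176) and the dimension-`0` factor -/

/-- **`P_{A × A'} = P_A · P_{A'}`** for the product `AbelianVariety.prod`: the tree's
`IsFrobCharpoly.bicone` at the biproduct `A ⊞ A'` (`biprod.total`), transported along the isomorphism
`A ⊞ A' ≅ A.prod A'` (`biprodIsoProd`, an isogeny). [cite: MumfordAV1970, §19 p. 176] -/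
theorem IsFrobCharpoly.prod {A A' : AbelianVariety K} {P Q : ℤ[X]} (hP : A.IsFrobCharpoly P)
    (hQ : A'.IsFrobCharpoly Q) : (A.prod A').IsFrobCharpoly (P * Q) := by
  have h : (A ⊞ A').IsFrobCharpoly (P * Q) := hP.bicone (BinaryBiproduct.bicone A A') biprod.total hQ
  exact h.of_isIsogeny_source (isIsogeny_hom_of_iso (biprodIsoProd A A'))

/-- An abelian variety of dimension `0` has characteristic polynomial of Frobenius `1`
(`rank_{ℤ_ℓ} T_ℓ A = 2 dim A = 0`, `finrank_tateModule_eq_two_mul_dim`, and the characteristic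
polynomial of an endomorphism of a free module of rank `0` is the monic polynomial of degree `0`).
[cite: MumfordAV1970, §19 p. 172 (`rank T_ℓ = 2g`)] -/
theorem IsFrobCharpoly.one_of_dim_eq_zero {A : AbelianVariety K} (hA : A.dim = 0) :
    A.IsFrobCharpoly 1 := by
  intro ℓ _ _ _ hℓ
  rw [Polynomial.map_one]
  have hdeg : (tateModuleMap ℓ (frobeniusHom A)).charpoly.natDegree = 0 := by
    rw [LinearMap.charpoly_natDegree, A.finrank_tateModule_eq_two_mul_dim ℓ hℓ, hA, mul_zero]
  exact Polynomial.eq_one_of_monic_natDegree_zero (LinearMap.charpoly_monic _) hdeg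

/-! ## Step 3: finite products of simple abelian varieties -/

/-- **`P_Π = ∏ P_{A_i}` for a finite product `Π` of simple abelian varieties**, the product taken over
its simple factors `A_i` of positive dimension, each with its characteristic polynomial of Frobenius
`Q_i` (induction on `IsProductOf IsSimple`; a factor of dimension `0` contributes `1`).
[cite: Zywina2014SplittingReductions, §2.1 (proof of Lemma 2.1)] [cite: MumfordAV1970, §19 p. 176] -/
theorem IsProductOf.exists_isFrobCharpoly_prod {D : AbelianVariety K} (hD : IsProductOf IsSimple D) :
    ∃ (n : ℕ) (A : Fin n → AbelianVariety K) (Q : Fin n → ℤ[X]),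
      (∀ i, (A i).IsSimple ∧ 0 < (A i).dim ∧ (A i).IsFrobCharpoly (Q i)) ∧
        D.IsFrobCharpoly (∏ i, Q i) := by
  induction hD with
  | @atom S hS =>
    rcases Nat.eq_zero_or_pos S.dim with h0 | hpos
    · refine ⟨0, Fin.elim0, Fin.elim0, fun i => i.elim0, ?_⟩
      rw [Finset.univ_eq_empty, Finset.prod_empty]
      exact IsFrobCharpoly.one_of_dim_eq_zero h0
    · obtain ⟨P, hP, -, -⟩ := exists_isFrobCharpoly S hpos
      refine ⟨1, fun _ => S, fun _ => P, fun _ => ⟨hS, hpos, hP⟩, ?_⟩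
      rw [Fin.prod_univ_one]
      exact hP
  | @prod S T _ _ ihS ihT =>
    obtain ⟨m, A, Q, hA, hSQ⟩ := ihS
    obtain ⟨n, B, R, hB, hTR⟩ := ihT
    refine ⟨m + n, Fin.append A B, Fin.append Q R, fun i => ?_, ?_⟩
    · refine Fin.addCases (fun i => ?_) (fun i => ?_) i
      · rw [Fin.append_left, Fin.append_left]
        exact hA i
      · rw [Fin.append_right, Fin.append_right]
        exact hB i
    · rw [Fin.prod_univ_add]
      simp only [Fin.append_left, Fin.append_right]
      exact hSQ.prod hTR

/-! ## Step 4: the discharge -/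

variable (K) in
/-- **Discharge of the named fact `frobCharpolyProdSimple`** (Poincaré–Weil complete reducibility over
`k = 𝔽_q`, read on characteristic polynomials of Frobenius): the characteristic polynomial of the
Frobenius of an abelian variety `C` of positive dimension over the finite field `K` is a finite product
of characteristic polynomials of Frobenius of `K`-simple abelian varieties of positive dimension.
Proof: `K` is perfect, so `C` receives an isogeny from a finite product `Π` of `K`-simple abelian
varieties (`exists_isogeny_from_productOf_simple_of_perfectField`, Milne 1986 Prop. 12.1 / Mumford § 19
Cor. 1 over `k`); `P_C = P_Π` (isogeny invariance) `= ∏ P_{A_i}` (multiplicativity), and `P_C` is unique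
(`IsFrobCharpoly.eq`). [cite: Tate1971HondaBourbaki, p. 95 and p. 99]
[cite: Waterhouse1969, p. 522 and Ch. 2 p. 526 (Theorem (Tate))]
[cite: Zywina2014SplittingReductions, §2.1 (proof of Lemma 2.1)] [cite: MumfordAV1970, §19 Thm. 1 and Cor. 1] -/
theorem frobCharpolyProdSimple_holds : frobCharpolyProdSimple K := by
  intro C _ P hP
  obtain ⟨D, g, hD, hg⟩ := exists_isogeny_from_productOf_simple_of_perfectField C
  obtain ⟨n, A, Q, hA, hDQ⟩ := hD.exists_isFrobCharpoly_prod
  exact ⟨n, A, Q, hA, hP.eq (hDQ.of_isIsogeny_source hg)⟩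

end AbelianVariety

end Literature.AlgebraicGeometry.Motives

end
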